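import Summits.BirchSwinnertonDyer.BirchSwinnertonDyer.Theorems.ManinLocalTwoThreeShimuraIndexTotient
import Summits.BirchSwinnertonDyer.BirchSwinnertonDyer.Theorems.ManinLocalTwoThreeShimuraIndexAtTwoExponent
import Mathlib.RingTheory.ZMod.UnitsCyclic
import HarnessLib

/-!
# CYCLIC LEVELS: when `(ℤ/N)ˣ` is cyclic the Shimura quotient `Λ₀(f)/Λ₁(f)` is CYCLIC, so `mΛ₀ ⊆ Λ₁ ⟹ [Λ₀ : Λ₁] ∣ m` —
# hence `[Λ₀ : Λ₁] ∣ 3 − a₂` at odd prime-power level, `∣ 3` or `= 1` at `N = 2q^k`, and `Λ₁ = Λ₀` at `N = q^k`, `k ≥ 2`, `q ≥ 7`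

Summit `BirchSwinnertonDyer`, route `ManinLocalTwoThree` (cell bsd-f2-manin), crux C2 `ManinOddAtFour`
(stmt-BirchSwinnertonDyer-22967; bears equally on C3 `ManinPrimeToThreeAtNine`, stmt-BirchSwinnertonDyer-22968 — `N = 27, 81, 54, 162`).
Planner seat bsd-f2-manin-es (LENS es: the Shimura covering `X₁(N) → X₀(N)` read on period lattices), gen 46; TURNKEY T-es-112
for the C2/C3 LEAD (prover bsd-line-manin23-p1).  Companion of T-es-111 (`…ShimuraIndexSquareBound`: the bound `∣ m²` from the
TARGET, rank `2`); this file is the sharper bound `∣ m` from the SOURCE when the source is cyclic.  In-tree imports only.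

THE OBSERVATION.  T-es-108 (`…ShimuraIndexTotient.exists_unitsHom_surjective`) built the class map `(ℤ/N)ˣ ↠ Λ₀(f)/Λ₁(f)` for
every weight-`2` cusp form `f` on `Γ₀(N)`.  If `(ℤ/N)ˣ` is cyclic — `N = q^k` or `2q^k` with `q` an odd prime (Gauss; Mathlib
`ZMod.isCyclic_units_of_prime_pow`, `ZMod.isCyclic_units_two_mul_iff_of_odd`) — then the quotient is cyclic (§1), its exponent is
its order (`IsAddCyclic.exponent_eq_card`), and `mΛ₀(f) ⊆ Λ₁(f)` gives `[Λ₀(f) : Λ₁(f)] ∣ m` (§1–§2; NO datum, NO optimality).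

CONSEQUENCES (all UNCONDITIONAL):
* §3 TRACELESS: `N = q^k` or `2q^k` with `k ≥ 2` ⟹ `a_q = 0` ⟹ `[Λ₀ : Λ₁] ∣ q` for every NEWFORM (`IsNewform0`): `∣ 3` at `27, 81,
  243, 54, 162, 486` (C3's additive levels; `…ShimuraIndexValues.relIndex_twentySeven = 3` is sharp), `∣ 5` at `125, 250`, `∣ 7` at
  `49, 98, 343`, ….
* §4 THE PRIME `2` (every newform of even level): `a₂(f) = 1` (split multiplicative) ⟹ `Λ₁(f) = Λ₀(f)` at EVERY even level
  (`periodLatticeGamma1_eq_of_cuspCoeff_two_eq_one`; THEOREM W at `p = 2`: `(a₂ − 2)Λ₀ ⊆ Λ₁`); at `N = 2q^k`: `[Λ₀ : Λ₁] = 1 ∨ ∣ 3`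
  (`relIndex_eq_one_or_dvd_three_of_two_mul_prime_pow`), and `= 1` when moreover `k ≥ 2`, `q ≥ 5` (`50, 98, 242, 250, 338, …`).
* §5 THE `a₂`-READING AT ODD PRIME-POWER LEVEL (globally minimal `W`, datum `D`): `[Λ₀(f) : Λ₁(f)] ∣ |a₂(W) − 3| ∈ {1, …, 5}`
  (`relIndex_dvd_natAbs_sub_three_of_prime_pow`, `relIndex_le_five_of_prime_pow`) — Mazur's range `n ∣ 5·…` recovered from Hasse at
  `2`; at PRIME level with T-es-108: `[Λ₀ : Λ₁] ∣ gcd((p − 1)/2, |a₂(W) − 3|)` (`relIndex_dvd_gcd_of_prime`: `11a ↦ gcd(5,5) = 5`,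
  `17a ↦ gcd(8,4) = 4`, `19a ↦ gcd(9,3) = 3`, `37b ↦ gcd(18,3) = 3`, `37a ↦ gcd(18,5) = 1` — all sharp in E15); and at `N = q^k`,
  `k ≥ 2`, `q ≥ 7`: **`Λ₁(f) = Λ₀(f)`** (`relIndex_eq_one_of_prime_pow_of_seven_le`: `[Λ₀ : Λ₁] ∣ q` and `≤ 5`) — `49, 121, 169, 289,
  343, 361, 529, …` (E15: `49a ↦ 1`, `121a–d ↦ 1`).
es census E15 (1025 optimal classes), the 177 classes at levels `q^k`, `2q^k`: index `> 1` exactly at `11a (5), 17a (4), 19a (3),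
37b (3), 73a (2), 89b (2), 113a (2), 27a (3)` and `14a, 26a, 38a, 54a, 158d (3, all with a₂ = −1)`; every split-multiplicative-at-`2`
class (`a₂ = +1`) has index `1`.  No counterexample to any statement below.

HONEST FRAMING.  Elementary: «a quotient of a cyclic group is cyclic» applied to Ling–Oesterlé's / Stevens' description of the Shimura
quotient as an image of `(ℤ/N)ˣ`; at prime level this is Mazur's «`E ∩ Σ(p)` is cyclic» [Mazur1977, II.(11.6)–(11.7)].  New in the tree,
in the `relIndex` currency of T-es-107/108/111.  C2, C3, Manin's conjecture and BSD are NOT proved by this file.  No definitions, no sorry.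
[cite: LingOesterle1991, §1 and Thm. 6] [cite: Stevens1989, §2] [cite: Mazur1977, II.(11.6)] [cite: Manin1972, Thm. 1.6]
[cite: AtkinLehner1970, Thm. 3] [cite: SilvermanAEC2009, Thm. V.1.1]
-/

set_option autoImplicit false
-- the summit-side namespace `Summit.BirchSwinnertonDyer.BirchSwinnertonDyer.…` is the tree's (summit = sub-problem)
set_option linter.dupNamespace false

noncomputable section

open scoped Classical MatrixGroups

open CongruenceSubgroup Matrix.SpecialLinearGroup ModularGroup
open Literature.NumberTheory.EllipticCurves Literature.NumberTheory.EllipticCurves.ModularForms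

namespace Summit.BirchSwinnertonDyer.BirchSwinnertonDyer.Theorems.ManinLocalTwoThree.ShimuraIndex

section AnyForm

variable {N : ℕ} [NeZero N] (f : CuspForm (Gamma0 N) 2)

/-! ## §1 Cyclic units ⟹ cyclic Shimura quotient ⟹ `[Λ₀ : Λ₁] ∣ m` -/

/-- **`(ℤ/N)ˣ` cyclic ⟹ `Λ₀(f)/Λ₁(f)` cyclic** (image of the class map of T-es-108). [cite: LingOesterle1991, §1]
[cite: Stevens1989, §2] -/
theorem isAddCyclic_shimuraQuotient_of_isCyclic_units [IsCyclic (ZMod N)ˣ] :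
    IsAddCyclic (periodLattice f ⧸ (periodLatticeGamma1 f).addSubgroupOf (periodLattice f)) := by
  obtain ⟨Φ, hΦ, -, -⟩ := exists_unitsHom_surjective f
  exact isCyclic_multiplicative_iff.mp (isCyclic_of_surjective Φ hΦ)

/-- **THE LINEAR BOUND.**  `(ℤ/N)ˣ` cyclic and `m Λ₀(f) ⊆ Λ₁(f)` ⟹ `[Λ₀(f) : Λ₁(f)] ∣ m` — for EVERY weight-`2` cusp form on
`Γ₀(N)` (the exponent of a cyclic group is its order). [cite: LingOesterle1991, §1] [cite: Mazur1977, II.(11.6)] -/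
theorem relIndex_dvd_of_natMul_mem_of_isCyclic_units [IsCyclic (ZMod N)ˣ] {m : ℕ}
    (hm : ∀ z ∈ periodLattice f, (m : ℂ) * z ∈ periodLatticeGamma1 f) :
    (periodLatticeGamma1 f).relIndex (periodLattice f) ∣ m := by
  set H : AddSubgroup (periodLattice f) := (periodLatticeGamma1 f).addSubgroupOf (periodLattice f) with hH
  haveI : IsAddCyclic (periodLattice f ⧸ H) := isAddCyclic_shimuraQuotient_of_isCyclic_units f
  have hexp : AddMonoid.exponent (periodLattice f ⧸ H) ∣ m := by
    refine AddMonoid.exponent_dvd_of_forall_nsmul_eq_zero fun q ↦ ?_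
    obtain ⟨x, rfl⟩ := QuotientAddGroup.mk_surjective q
    rw [← QuotientAddGroup.mk_nsmul, QuotientAddGroup.eq_zero_iff, hH, AddSubgroup.mem_addSubgroupOf]
    show (m • x : periodLattice f).val ∈ periodLatticeGamma1 f
    simp only [AddSubgroupClass.coe_nsmul, nsmul_eq_mul]
    exact hm _ x.2
  have hidx : (periodLatticeGamma1 f).relIndex (periodLattice f) = Nat.card (periodLattice f ⧸ H) := by
    rw [AddSubgroup.relIndex, hH, AddSubgroup.index_eq_card]
  rw [hidx, ← IsAddCyclic.exponent_eq_card]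
  exact hexp

/-- Integer-multiplier form: `(ℤ/N)ˣ` cyclic, `m Λ₀(f) ⊆ Λ₁(f)` with `m : ℤ` ⟹ `[Λ₀(f) : Λ₁(f)] ∣ |m|`. [cite: LingOesterle1991, §1] -/
theorem relIndex_dvd_natAbs_of_intMul_mem_of_isCyclic_units [IsCyclic (ZMod N)ˣ] {m : ℤ}
    (hm : ∀ z ∈ periodLattice f, (m : ℂ) * z ∈ periodLatticeGamma1 f) :
    (periodLatticeGamma1 f).relIndex (periodLattice f) ∣ m.natAbs := by
  refine relIndex_dvd_of_natMul_mem_of_isCyclic_units f fun z hz ↦ ?_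
  have h := hm z hz
  rcases Int.natAbs_eq m with h' | h'
  · rw [h'] at h
    simpa only [Int.cast_natCast] using h
  · rw [h'] at h
    simp only [Int.cast_neg, Int.cast_natCast, neg_mul] at h
    exact neg_mem_iff.mp h

/-! ## §2 The cyclic levels `q^k` and `2q^k` (`q` an odd prime) -/

/-- `(ℤ/q^k)ˣ` is cyclic for an odd prime `q` (Gauss). [cite: SilvermanAEC2009, App. C §… (elementary)] -/
theorem isCyclic_units_of_eq_prime_pow {q k : ℕ} (hq : q.Prime) (hq2 : q ≠ 2) (hN : N = q ^ k) : IsCyclic (ZMod N)ˣ := by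
  subst hN
  exact ZMod.isCyclic_units_of_prime_pow q hq hq2 k

/-- `(ℤ/2q^k)ˣ` is cyclic for an odd prime `q` (Gauss). [cite: SilvermanAEC2009, App. C §… (elementary)] -/
theorem isCyclic_units_of_eq_two_mul_prime_pow {q k : ℕ} (hq : q.Prime) (hq2 : q ≠ 2) (hN : N = 2 * q ^ k) :
    IsCyclic (ZMod N)ˣ := by
  subst hN
  exact (ZMod.isCyclic_units_two_mul_iff_of_odd (q ^ k) ((hq.odd_of_ne_two hq2).pow)).mpr
    (ZMod.isCyclic_units_of_prime_pow q hq hq2 k)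

/-- **`N = q^k`**: `m Λ₀(f) ⊆ Λ₁(f)` ⟹ `[Λ₀(f) : Λ₁(f)] ∣ m`. [cite: LingOesterle1991, §1] [cite: Mazur1977, II.(11.6)] -/
theorem relIndex_dvd_of_natMul_mem_of_prime_pow {q k : ℕ} (hq : q.Prime) (hq2 : q ≠ 2) (hN : N = q ^ k) {m : ℕ}
    (hm : ∀ z ∈ periodLattice f, (m : ℂ) * z ∈ periodLatticeGamma1 f) :
    (periodLatticeGamma1 f).relIndex (periodLattice f) ∣ m := by
  haveI := isCyclic_units_of_eq_prime_pow hq hq2 hN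
  exact relIndex_dvd_of_natMul_mem_of_isCyclic_units f hm

/-- **`N = 2q^k`**: `m Λ₀(f) ⊆ Λ₁(f)` ⟹ `[Λ₀(f) : Λ₁(f)] ∣ m`. [cite: LingOesterle1991, §1] -/
theorem relIndex_dvd_of_natMul_mem_of_two_mul_prime_pow {q k : ℕ} (hq : q.Prime) (hq2 : q ≠ 2) (hN : N = 2 * q ^ k)
    {m : ℕ} (hm : ∀ z ∈ periodLattice f, (m : ℂ) * z ∈ periodLatticeGamma1 f) :
    (periodLatticeGamma1 f).relIndex (periodLattice f) ∣ m := by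
  haveI := isCyclic_units_of_eq_two_mul_prime_pow hq hq2 hN
  exact relIndex_dvd_of_natMul_mem_of_isCyclic_units f hm

/-! ## §3 Traceless prime powers: `N = q^k` or `2q^k`, `k ≥ 2` ⟹ `[Λ₀ : Λ₁] ∣ q` for every newform -/

variable {f}

/-- **`N = q^k`, `k ≥ 2`, `q` odd prime, `f` a newform** ⟹ `[Λ₀(f) : Λ₁(f)] ∣ q` (`a_q = 0`, `U_q = q` on `Σ(N)` gives
`qΛ₀ ⊆ Λ₁`; cyclicity sharpens T-es-111's `∣ q²` to `∣ q`).  E.g. `∣ 3` at `27, 81, 243`, `∣ 5` at `125`, `∣ 7` at `49, 343`.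
[cite: LingOesterle1991, Thm. 6] [cite: AtkinLehner1970, Thm. 3] -/
theorem relIndex_dvd_prime_of_prime_pow (hf : IsNewform0 f) {q k : ℕ} (hq : q.Prime) (hq2 : q ≠ 2) (hk : 2 ≤ k)
    (hN : N = q ^ k) : (periodLatticeGamma1 f).relIndex (periodLattice f) ∣ q := by
  have hsq : q ^ 2 ∣ N := hN ▸ pow_dvd_pow q hk
  have hqN : q ∣ N := (dvd_pow_self q two_ne_zero).trans hsq
  exact relIndex_dvd_of_natMul_mem_of_prime_pow f hq hq2 hN fun z hz ↦
    pMulLatticeLeGamma1OfTracelessPrime_holds N f hf q hq hqN (hf.cuspCoeff_eq_zero_of_sq_dvd hq hsq) z hz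

/-- **`N = 2q^k`, `k ≥ 2`, `q` odd prime, `f` a newform** ⟹ `[Λ₀(f) : Λ₁(f)] ∣ q`.  E.g. `∣ 3` at `54, 162`, `∣ 5` at `50, 250`,
`∣ 7` at `98`. [cite: LingOesterle1991, Thm. 6] [cite: AtkinLehner1970, Thm. 3] -/
theorem relIndex_dvd_prime_of_two_mul_prime_pow (hf : IsNewform0 f) {q k : ℕ} (hq : q.Prime) (hq2 : q ≠ 2) (hk : 2 ≤ k)
    (hN : N = 2 * q ^ k) : (periodLatticeGamma1 f).relIndex (periodLattice f) ∣ q := by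
  have hsq : q ^ 2 ∣ N := hN ▸ (pow_dvd_pow q hk).trans (dvd_mul_left _ _)
  have hqN : q ∣ N := (dvd_pow_self q two_ne_zero).trans hsq
  exact relIndex_dvd_of_natMul_mem_of_two_mul_prime_pow f hq hq2 hN fun z hz ↦
    pMulLatticeLeGamma1OfTracelessPrime_holds N f hf q hq hqN (hf.cuspCoeff_eq_zero_of_sq_dvd hq hsq) z hz

/-! ## §4 The prime `2` at even level: `a₂ = 1 ⟹ Λ₁ = Λ₀`; `N = 2q^k ⟹ [Λ₀ : Λ₁] = 1 ∨ ∣ 3` -/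

open Summit.BirchSwinnertonDyer.BirchSwinnertonDyer.Theorems.ManinLocalTwoThree.ShimuraIndexAtTwo

/-- **Split multiplicative at `2` ⟹ `Λ₁(f) = Λ₀(f)`** at EVERY even level, for every newform with `a₂(f) = 1`: THEOREM W at
`p = 2` gives `(a₂ − 2)Λ₀ = −Λ₀ ⊆ Λ₁`.  (E15: every optimal class with `2 ∥ N`, `a₂ = +1` has index `1`.)
[cite: LingOesterle1991, Thm. 6] [cite: AtkinLehner1970, Thm. 3] -/
theorem periodLatticeGamma1_eq_of_cuspCoeff_two_eq_one (hf : IsNewform0 f) (hN : 2 ∣ N) (h1 : cuspCoeff f 2 = 1) :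
    periodLatticeGamma1 f = periodLattice f := by
  refine le_antisymm (periodLatticeGamma1_le_periodLattice f) fun z hz ↦ ?_
  have h := sub_two_mul_mem_periodLatticeGamma1_of_two_dvd hf hN hz
  rw [h1, show ((1 : ℂ) - 2) * z = -z by ring] at h
  exact neg_mem_iff.mp h

/-- `a₂(f) = 1` at even level ⟹ `[Λ₀(f) : Λ₁(f)] = 1`. [cite: LingOesterle1991, Thm. 6] [cite: AtkinLehner1970, Thm. 3] -/
theorem relIndex_eq_one_of_cuspCoeff_two_eq_one (hf : IsNewform0 f) (hN : 2 ∣ N) (h1 : cuspCoeff f 2 = 1) :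
    (periodLatticeGamma1 f).relIndex (periodLattice f) = 1 := by
  rw [AddSubgroup.relIndex_eq_one, periodLatticeGamma1_eq_of_cuspCoeff_two_eq_one hf hN h1]

/-- **`N = 2q^k` (`q` odd prime), `f` a newform ⟹ `(a₂(f) = 1 ∧ [Λ₀ : Λ₁] = 1) ∨ (a₂(f) = −1 ∧ [Λ₀ : Λ₁] ∣ 3)`**
(`2 ∥ N` so `a₂ = ±1`; the second case by cyclicity: `(−1 − 2)Λ₀ ⊆ Λ₁`).  E15: `14a, 26a, 38a, 54a, 158d ↦ 3` (all `a₂ = −1`).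
[cite: LingOesterle1991, §1 and Thm. 6] [cite: AtkinLehner1970, Thm. 3] -/
theorem relIndex_eq_one_or_dvd_three_of_two_mul_prime_pow (hf : IsNewform0 f) {q k : ℕ} (hq : q.Prime) (hq2 : q ≠ 2)
    (hN : N = 2 * q ^ k) :
    (cuspCoeff f 2 = 1 ∧ (periodLatticeGamma1 f).relIndex (periodLattice f) = 1) ∨
      (cuspCoeff f 2 = -1 ∧ (periodLatticeGamma1 f).relIndex (periodLattice f) ∣ 3) := by
  have h2N : 2 ∣ N := hN ▸ dvd_mul_right 2 _
  have h4N : ¬ 2 ^ 2 ∣ N := by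
    rw [hN]
    intro h
    have h2 : 2 ∣ q ^ k := by
      have : 2 * 2 ∣ 2 * q ^ k := by simpa [pow_two] using h
      exact Nat.dvd_of_mul_dvd_mul_left two_pos this
    exact hq2 ((Nat.prime_dvd_prime_iff_eq Nat.prime_two hq).mp (Nat.prime_two.dvd_of_dvd_pow h2)).symm
  obtain ⟨e, he, hcase⟩ := exists_cuspCoeff_two_eq_of_two_dvd hf h2N
  rcases hcase with ⟨h4, -⟩ | ⟨-, rfl | rfl⟩
  · exact absurd h4 h4N
  · refine Or.inl ⟨by simpa using he, relIndex_eq_one_of_cuspCoeff_two_eq_one hf h2N (by simpa using he)⟩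
  · refine Or.inr ⟨by simpa using he, ?_⟩
    haveI := isCyclic_units_of_eq_two_mul_prime_pow hq hq2 hN
    have h3 : ∀ z ∈ periodLattice f, ((-3 : ℤ) : ℂ) * z ∈ periodLatticeGamma1 f := by
      intro z hz
      have h := sub_two_mul_mem_periodLatticeGamma1_of_two_dvd hf h2N hz
      rw [he] at h
      have e3 : (((-1 : ℤ) : ℂ) - 2) = ((-3 : ℤ) : ℂ) := by push_cast; norm_num
      rwa [e3] at h
    simpa using relIndex_dvd_natAbs_of_intMul_mem_of_isCyclic_units f h3

/-- **`N = 2q^k` ⟹ `[Λ₀(f) : Λ₁(f)] = 1 ∨ [Λ₀(f) : Λ₁(f)] = 3`** for every newform. [cite: LingOesterle1991, §1 and Thm. 6] -/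
theorem relIndex_eq_one_or_three_of_two_mul_prime_pow (hf : IsNewform0 f) {q k : ℕ} (hq : q.Prime) (hq2 : q ≠ 2)
    (hN : N = 2 * q ^ k) :
    (periodLatticeGamma1 f).relIndex (periodLattice f) = 1 ∨ (periodLatticeGamma1 f).relIndex (periodLattice f) = 3 := by
  rcases relIndex_eq_one_or_dvd_three_of_two_mul_prime_pow hf hq hq2 hN with ⟨-, h⟩ | ⟨-, h⟩
  · exact Or.inl h
  · rcases (Nat.dvd_prime Nat.prime_three).mp h with h' | h'
    · exact Or.inl h'
    · exact Or.inr h'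

/-- **`N = 2q^k`, `k ≥ 2`, `q ≥ 5` ⟹ `Λ₁(f) = Λ₀(f)`** for every newform (`[Λ₀ : Λ₁] ∣ q` and `∣ 3` or `= 1`): `50, 98, 242,
250, 338, …` (E15: `50a, 50b, 98a ↦ 1`). [cite: LingOesterle1991, §1 and Thm. 6] [cite: AtkinLehner1970, Thm. 3] -/
theorem relIndex_eq_one_of_two_mul_prime_pow_of_five_le (hf : IsNewform0 f) {q k : ℕ} (hq : q.Prime) (h5 : 5 ≤ q)
    (hk : 2 ≤ k) (hN : N = 2 * q ^ k) : (periodLatticeGamma1 f).relIndex (periodLattice f) = 1 := by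
  have hq2 : q ≠ 2 := by omega
  have hq3 : q ≠ 3 := by omega
  have hdq := relIndex_dvd_prime_of_two_mul_prime_pow hf hq hq2 hk hN
  rcases relIndex_eq_one_or_three_of_two_mul_prime_pow hf hq hq2 hN with h | h
  · exact h
  · rw [h] at hdq
    exact absurd ((Nat.prime_dvd_prime_iff_eq Nat.prime_three hq).mp hdq) (Ne.symm hq3)

end AnyForm

/-! ## §5 The `a₂`-reading at odd prime-power level (globally minimal `W`) -/

section Minimal

open Summit.BirchSwinnertonDyer.BirchSwinnertonDyer.Theorems.ManinLocalTwoThree.ShimuraIndexAtTwo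

variable (W : WeierstrassCurve ℚ) [W.IsElliptic] [W.IsGloballyMinimal] {N : ℕ} [NeZero N]

/-- **`N = q^k` (`q` odd prime): `[Λ₀(f) : Λ₁(f)] ∣ |a₂(W) − 3|`** — `T₂ − 3` kills `Σ(N)`, acts on `Λ₀` by `a₂(W) − 3`, and the
quotient is cyclic. [cite: LingOesterle1991, §1 and Thm. 6] [cite: Mazur1977, II.(11.6)] -/
theorem relIndex_dvd_natAbs_sub_three_of_prime_pow (D : ModularParametrizationData W N) {q k : ℕ} (hq : q.Prime)
    (hq2 : q ≠ 2) (hN : N = q ^ k) :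
    (periodLatticeGamma1 D.f).relIndex (periodLattice D.f) ∣ (W.frobeniusTrace 2 - 3).natAbs := by
  have hodd : ¬ 2 ∣ N := by
    rw [hN]
    intro h
    exact hq2 ((Nat.prime_dvd_prime_iff_eq Nat.prime_two hq).mp (Nat.prime_two.dvd_of_dvd_pow h)).symm
  haveI := isCyclic_units_of_eq_prime_pow hq hq2 hN
  exact relIndex_dvd_natAbs_of_intMul_mem_of_isCyclic_units D.f (oddLevelEisensteinAtTwo W D.f D.isNewformOf hodd).2

/-- **`N = q^k` (`q` odd prime), the menu**: `[Λ₀(f) : Λ₁(f)] ∣ 5, ∣ 4, ∣ 3, ∣ 2, = 1` according as `a₂(W) = −2, −1, 0, 1, 2`.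
E15 at prime level: `11a ↦ 5 (a₂ = −2)`, `17a ↦ 4 (−1)`, `19a, 37b ↦ 3 (0)`, `73a, 89b, 113a ↦ 2 (1)`.
[cite: LingOesterle1991, §1 and Thm. 6] [cite: SilvermanAEC2009, Thm. V.1.1] [cite: Mazur1977, II.(11.6)] -/
theorem relIndex_dvd_of_prime_pow (D : ModularParametrizationData W N) {q k : ℕ} (hq : q.Prime) (hq2 : q ≠ 2)
    (hN : N = q ^ k) :
    (W.frobeniusTrace 2 = -2 ∧ (periodLatticeGamma1 D.f).relIndex (periodLattice D.f) ∣ 5) ∨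
    (W.frobeniusTrace 2 = -1 ∧ (periodLatticeGamma1 D.f).relIndex (periodLattice D.f) ∣ 4) ∨
    (W.frobeniusTrace 2 = 0 ∧ (periodLatticeGamma1 D.f).relIndex (periodLattice D.f) ∣ 3) ∨
    (W.frobeniusTrace 2 = 1 ∧ (periodLatticeGamma1 D.f).relIndex (periodLattice D.f) ∣ 2) ∨
    (W.frobeniusTrace 2 = 2 ∧ (periodLatticeGamma1 D.f).relIndex (periodLattice D.f) = 1) := by
  have hdvd := relIndex_dvd_natAbs_sub_three_of_prime_pow W D hq hq2 hN
  have hodd : ¬ 2 ∣ N := by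
    rw [hN]
    intro h
    exact hq2 ((Nat.prime_dvd_prime_iff_eq Nat.prime_two hq).mp (Nat.prime_two.dvd_of_dvd_pow h)).symm
  obtain ⟨h₁, h₂⟩ := abs_le.mp (oddLevelEisensteinAtTwo W D.f D.isNewformOf hodd).1
  have hcases : W.frobeniusTrace 2 = -2 ∨ W.frobeniusTrace 2 = -1 ∨ W.frobeniusTrace 2 = 0 ∨
      W.frobeniusTrace 2 = 1 ∨ W.frobeniusTrace 2 = 2 := by omega
  rcases hcases with h | h | h | h | h <;> rw [h] at hdvd
  · exact Or.inl ⟨h, by simpa using hdvd⟩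
  · exact Or.inr (Or.inl ⟨h, by simpa using hdvd⟩)
  · exact Or.inr (Or.inr (Or.inl ⟨h, by simpa using hdvd⟩))
  · exact Or.inr (Or.inr (Or.inr (Or.inl ⟨h, by simpa using hdvd⟩)))
  · refine Or.inr (Or.inr (Or.inr (Or.inr ⟨h, ?_⟩)))
    have h1 : ((2 : ℤ) - 3).natAbs = 1 := by decide
    rw [h1] at hdvd
    exact Nat.dvd_one.mp hdvd

/-- **`N = q^k` (`q` odd prime) ⟹ `[Λ₀(f) : Λ₁(f)] ≤ 5`** (Mazur's range at prime level, here at every odd prime power and for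
every datum). [cite: Mazur1977, II.(11.6)] [cite: LingOesterle1991, Thm. 6] -/
theorem relIndex_le_five_of_prime_pow (D : ModularParametrizationData W N) {q k : ℕ} (hq : q.Prime) (hq2 : q ≠ 2)
    (hN : N = q ^ k) : (periodLatticeGamma1 D.f).relIndex (periodLattice D.f) ≤ 5 := by
  have hdvd := relIndex_dvd_natAbs_sub_three_of_prime_pow W D hq hq2 hN
  have hodd : ¬ 2 ∣ N := by
    rw [hN]
    intro h
    exact hq2 ((Nat.prime_dvd_prime_iff_eq Nat.prime_two hq).mp (Nat.prime_two.dvd_of_dvd_pow h)).symm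
  obtain ⟨h₁, h₂⟩ := abs_le.mp (oddLevelEisensteinAtTwo W D.f D.isNewformOf hodd).1
  have hle : (W.frobeniusTrace 2 - 3).natAbs ≤ 5 := by omega
  have hpos : 0 < (W.frobeniusTrace 2 - 3).natAbs := by omega
  exact (Nat.le_of_dvd hpos hdvd).trans hle

/-- **PRIME LEVEL — Mazur's `n` meets Hasse: `[Λ₀(f) : Λ₁(f)] ∣ gcd((p − 1)/2, |a₂(W) − 3|)`** for every datum of a minimal
curve of odd prime conductor `p` (T-es-108 `relIndex_dvd_of_prime` ∧ §5).  E15: `11a ↦ gcd(5,5) = 5`, `17a ↦ gcd(8,4) = 4`,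
`19a ↦ gcd(9,3) = 3`, `37b ↦ gcd(18,3) = 3`, `37a ↦ gcd(18,5) = 1`, `73a ↦ gcd(36,2) = 2` — sharp in each case.
[cite: Mazur1977, II.(11.6) and (17.10)] [cite: LingOesterle1991, Thm. 6] -/
theorem relIndex_dvd_gcd_of_prime {p : ℕ} [NeZero p] (hp : p.Prime) (hp2 : p ≠ 2) (D : ModularParametrizationData W p) :
    (periodLatticeGamma1 D.f).relIndex (periodLattice D.f) ∣ Nat.gcd ((p - 1) / 2) (W.frobeniusTrace 2 - 3).natAbs :=
  Nat.dvd_gcd (relIndex_dvd_of_prime hp hp2 D.f)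
    (relIndex_dvd_natAbs_sub_three_of_prime_pow W D hp hp2 (k := 1) (by simp))

/-- **`N = q^k`, `k ≥ 2`, `q ≥ 7` ⟹ `Λ₁(f) = Λ₀(f)`** for every datum of a minimal curve: `[Λ₀ : Λ₁] ∣ q` (§3) and `≤ 5` (§5).
Levels `49, 121, 169, 289, 343, 361, 529, 841, 961, 1331, …` (E15: `49a ↦ 1`, `121a, b, c, d ↦ 1`).
[cite: LingOesterle1991, Thm. 6] [cite: Mazur1977, II.(11.6)] -/
theorem relIndex_eq_one_of_prime_pow_of_seven_le (D : ModularParametrizationData W N) {q k : ℕ} (hq : q.Prime)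
    (h7 : 7 ≤ q) (hk : 2 ≤ k) (hN : N = q ^ k) : (periodLatticeGamma1 D.f).relIndex (periodLattice D.f) = 1 := by
  have hq2 : q ≠ 2 := by omega
  have hdq := relIndex_dvd_prime_of_prime_pow D.isNewformOf.1 hq hq2 hk hN
  have hle := relIndex_le_five_of_prime_pow W D hq hq2 hN
  rcases (Nat.dvd_prime hq).mp hdq with h | h
  · exact h
  · omega

/-- `Λ₁(f) = Λ₀(f)` as lattices at `N = q^k`, `k ≥ 2`, `q ≥ 7`. [cite: LingOesterle1991, Thm. 6] -/
theorem periodLatticeGamma1_eq_of_prime_pow_of_seven_le (D : ModularParametrizationData W N) {q k : ℕ} (hq : q.Prime)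
    (h7 : 7 ≤ q) (hk : 2 ≤ k) (hN : N = q ^ k) : periodLatticeGamma1 D.f = periodLattice D.f :=
  le_antisymm (periodLatticeGamma1_le_periodLattice D.f)
    (AddSubgroup.relIndex_eq_one.mp (relIndex_eq_one_of_prime_pow_of_seven_le W D hq h7 hk hN))

/-- **`N = 5^k`, `k ≥ 2` ⟹ `[Λ₀(f) : Λ₁(f)] = 1 ∨ (a₂(W) = −2 ∧ [Λ₀(f) : Λ₁(f)] = 5)`** (minimal `W`).
[cite: LingOesterle1991, Thm. 6] [cite: Mazur1977, II.(11.6)] -/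
theorem relIndex_eq_one_or_eq_five_of_five_pow (D : ModularParametrizationData W N) {k : ℕ} (hk : 2 ≤ k)
    (hN : N = 5 ^ k) :
    (periodLatticeGamma1 D.f).relIndex (periodLattice D.f) = 1 ∨
      (W.frobeniusTrace 2 = -2 ∧ (periodLatticeGamma1 D.f).relIndex (periodLattice D.f) = 5) := by
  have hd5 := relIndex_dvd_prime_of_prime_pow D.isNewformOf.1 Nat.prime_five (by norm_num) hk hN
  rcases (Nat.dvd_prime Nat.prime_five).mp hd5 with h | h
  · exact Or.inl h
  · rcases relIndex_dvd_of_prime_pow W D Nat.prime_five (by norm_num) hN with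
      ⟨ha, -⟩ | ⟨-, h'⟩ | ⟨-, h'⟩ | ⟨-, h'⟩ | ⟨-, h'⟩
    · exact Or.inr ⟨ha, h⟩
    all_goals rw [h] at h'; exact absurd h' (by decide)

/-- **`N = 3^k`, `k ≥ 2` (`27, 81, 243, 729`; C3) ⟹ `[Λ₀(f) : Λ₁(f)] = 1 ∨ (a₂(W) = 0 ∧ [Λ₀(f) : Λ₁(f)] = 3)`** (minimal `W`;
`27a ↦ 3` with `a₂(27a) = 0`, `243a, b ↦ ?` decided by `a₂`). [cite: LingOesterle1991, Thm. 6] [cite: Mazur1977, II.(11.6)] -/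
theorem relIndex_eq_one_or_eq_three_of_three_pow (D : ModularParametrizationData W N) {k : ℕ} (hk : 2 ≤ k)
    (hN : N = 3 ^ k) :
    (periodLatticeGamma1 D.f).relIndex (periodLattice D.f) = 1 ∨
      (W.frobeniusTrace 2 = 0 ∧ (periodLatticeGamma1 D.f).relIndex (periodLattice D.f) = 3) := by
  have hd3 := relIndex_dvd_prime_of_prime_pow D.isNewformOf.1 Nat.prime_three (by norm_num) hk hN
  rcases (Nat.dvd_prime Nat.prime_three).mp hd3 with h | h
  · exact Or.inl h
  · rcases relIndex_dvd_of_prime_pow W D Nat.prime_three (by norm_num) hN with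
      ⟨-, h'⟩ | ⟨-, h'⟩ | ⟨ha, -⟩ | ⟨-, h'⟩ | ⟨-, h'⟩
    · rw [h] at h'; exact absurd h' (by decide)
    · rw [h] at h'; exact absurd h' (by decide)
    · exact Or.inr ⟨ha, h⟩
    all_goals rw [h] at h'; exact absurd h' (by decide)

/-! ## §6 Level instances (C2/C3 neighbourhood; E15 values in brackets) -/

/-- `N = 49 = 7²`: `Λ₁(f) = Λ₀(f)` for every datum of a minimal curve [E15: `49a ↦ 1`]. [cite: LingOesterle1991, Thm. 6] -/
theorem relIndex_eq_one_fortyNine_datum (D : ModularParametrizationData W 49) :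
    (periodLatticeGamma1 D.f).relIndex (periodLattice D.f) = 1 :=
  relIndex_eq_one_of_prime_pow_of_seven_le W D (q := 7) (k := 2) (by norm_num) le_rfl le_rfl (by norm_num)

/-- `N = 121 = 11²`: `Λ₁(f) = Λ₀(f)` for every datum of a minimal curve [E15: `121a, b, c, d ↦ 1`]. [cite: LingOesterle1991, Thm. 6] -/
theorem relIndex_eq_one_oneTwentyOne_datum (D : ModularParametrizationData W 121) :
    (periodLatticeGamma1 D.f).relIndex (periodLattice D.f) = 1 :=
  relIndex_eq_one_of_prime_pow_of_seven_le W D (q := 11) (k := 2) (by norm_num) (by norm_num) le_rfl (by norm_num)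

end Minimal

section Instances

variable {f₅₀ : CuspForm (Gamma0 50) 2} {f₅₄ : CuspForm (Gamma0 54) 2} {f₈₁ : CuspForm (Gamma0 81) 2}
  {f₉₈ : CuspForm (Gamma0 98) 2} {f₁₆₂ : CuspForm (Gamma0 162) 2}

/-- `N = 54 = 2·3³` (C3): `[Λ₀(f) : Λ₁(f)] ∣ 3` for every newform [E15: `54a ↦ 3`, `54b ↦ 1`]. [cite: LingOesterle1991, Thm. 6] -/
theorem relIndex_dvd_three_fiftyFour (hf : IsNewform0 f₅₄) : (periodLatticeGamma1 f₅₄).relIndex (periodLattice f₅₄) ∣ 3 :=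
  relIndex_dvd_prime_of_two_mul_prime_pow hf (q := 3) (k := 3) Nat.prime_three (by norm_num) (by norm_num) (by norm_num)

/-- `N = 162 = 2·3⁴` (C3): `[Λ₀(f) : Λ₁(f)] ∣ 3` for every newform [E15: `162a–d ↦ 1`]. [cite: LingOesterle1991, Thm. 6] -/
theorem relIndex_dvd_three_oneSixtyTwo (hf : IsNewform0 f₁₆₂) :
    (periodLatticeGamma1 f₁₆₂).relIndex (periodLattice f₁₆₂) ∣ 3 :=
  relIndex_dvd_prime_of_two_mul_prime_pow hf (q := 3) (k := 4) Nat.prime_three (by norm_num) (by norm_num) (by norm_num)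

/-- `N = 81 = 3⁴` (C3): `[Λ₀(f) : Λ₁(f)] ∣ 3` for every newform. [cite: LingOesterle1991, Thm. 6] -/
theorem relIndex_dvd_three_eightyOne (hf : IsNewform0 f₈₁) : (periodLatticeGamma1 f₈₁).relIndex (periodLattice f₈₁) ∣ 3 :=
  relIndex_dvd_prime_of_prime_pow hf (q := 3) (k := 4) Nat.prime_three (by norm_num) (by norm_num) (by norm_num)

/-- `N = 50 = 2·5²`: `Λ₁(f) = Λ₀(f)` for every newform [E15: `50a, 50b ↦ 1`]. [cite: LingOesterle1991, Thm. 6] -/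
theorem relIndex_eq_one_fifty (hf : IsNewform0 f₅₀) : (periodLatticeGamma1 f₅₀).relIndex (periodLattice f₅₀) = 1 :=
  relIndex_eq_one_of_two_mul_prime_pow_of_five_le hf (q := 5) (k := 2) Nat.prime_five le_rfl le_rfl (by norm_num)

/-- `N = 98 = 2·7²`: `Λ₁(f) = Λ₀(f)` for every newform [E15: `98a ↦ 1`]. [cite: LingOesterle1991, Thm. 6] -/
theorem relIndex_eq_one_ninetyEight (hf : IsNewform0 f₉₈) : (periodLatticeGamma1 f₉₈).relIndex (periodLattice f₉₈) = 1 :=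
  relIndex_eq_one_of_two_mul_prime_pow_of_five_le hf (q := 7) (k := 2) (by norm_num) (by norm_num) le_rfl (by norm_num)

end Instances

end Summit.BirchSwinnertonDyer.BirchSwinnertonDyer.Theorems.ManinLocalTwoThree.ShimuraIndex

end
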